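import Literature.AlgebraicGeometry.Frobenioids.ArchimedeanQuotientLiftingProofs
import Literature.AlgebraicGeometry.Frobenioids.ArchimedeanAngloidCoAngular
import Literature.AlgebraicGeometry.Frobenioids.ArchimedeanSlitMorphisms
import HarnessLib

/-!
# Frobenioids II, Proposition 3.5 (i) REPAIRED for the angular Frobenioid `A` (statement + proof)

Mochizuki, *The geometry of Frobenioids II: poly-Frobenioids*, Kyushu J. Math. **62** (2008) 401–460,
§3, Proposition 3.5 (i), kurims p. 34 [cite: MochizukiFrdII2008, Prop 3.5 (i) p.34], for `H = A` "the
subcategory determined by the isometries" of `C = C₀ ×_{D₀} D` ([FrdII] Ex. 3.3 (iii)). Companion of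
`ArchimedeanQuotientLifting.lean` / `…Proofs.lean` (the case `H = C`): the same lift works inside `A`,
because every arrow the construction produces — the pull-back arrow `(b, 1, 1)`, the twists `(σ, 1, 1)`,
the test arrows of the monomorphism argument — has scalar of absolute value `1`, degree `1` and source tip
= target tip, i.e. is an isometry (`A0.isIsometry_iff_norm_mul_tip_pow`), and because `Φ₀ = ℝ_{≥0}` is sharp:
a factorisation in `C` of an arrow of `A` is a factorisation in `A` (`C0.isIsometry_of_comp`).
* `ArchFrd.Prop35iR_A π` — the repaired statement (abc-iut-L1-t9's `Prop35i_A` + Galois saturation).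
* `QuotientLiftA.liftMorA`, `isPullbackMorphism_liftMorA` (pull-back morphism OF `A` lifting `f_D`),
  `liftAutHomA : G_D → Aut_A(B)`, `isCategoricalQuotient_liftMorA`, `isMonoMinimalQuotient_liftMorA`.
* **`prop35iR_A_holds : ArchFrd.Prop35iR_A π`** for every functor `π : D → D₀`.
Nothing here bears on [IUTchIII] Cor. 3.12; typed ≠ proved except where a `theorem` says so.
-/

namespace Literature.AlgebraicGeometry.Frobenioids

open CategoryTheory
open scoped Pointwise

noncomputable section

universe v u

namespace ArchFrd

variable {D : Type u} [Category.{v} D] (π : D ⥤ D0)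

/-- **Prop. 3.5 (i) REPAIRED for `H = A`** (instance shape of `ArchFrd.Prop35i_A`, plus Galois saturation).
[cite: MochizukiFrdII2008, Prop 3.5 (i) p.34] -/
def Prop35iR_A : Prop := Prop35iR π (baseRC π) (A.toElem π) (𝟭 (A π))

/-- `Φ₀` is sharp: both factors of a factorisation in `C` of an isometry are isometries.
[cite: MochizukiFrdII2008, Ex 3.3 (iii) p.29] -/
theorem C.isIsometry_of_fac {X Y Z : C π} (ψ : X ⟶ Y) (φ : Y ⟶ Z)
    (h : PreFrobenioid.IsIsometry (C.toElem π) (ψ ≫ φ)) :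
    PreFrobenioid.IsIsometry (C.toElem π) ψ ∧ PreFrobenioid.IsIsometry (C.toElem π) φ := by
  rw [PreFrobenioid.isIsometry_fiberProduct_iff] at h ⊢
  rw [PreFrobenioid.isIsometry_fiberProduct_iff]
  exact C0.isIsometry_of_comp ψ.fst φ.fst h

namespace QuotientLiftA

variable (Q : ArchFrd.A π) {BD : D} (fD : BD ⟶ Q.obj.snd) (GD : Subgroup (Aut BD))

/-! ### The lift lies in `A` -/

/-- An arrow `(θ, 1, 1)` of `C₀` between objects with the same tip is an isometry.
[cite: MochizukiFrdII2008, Ex 3.3 (iii) p.28] -/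
theorem isIsometry_of_one_one {X Y : C0} (φ : X ⟶ Y) (hd : C0.degFr φ = 1) (hs : C0.scalar φ = 1)
    (ht : X.region.tip = Y.region.tip) : PreFrobenioid.IsIsometry C0.toElem φ := by
  rw [A0.isIsometry_iff_norm_mul_tip_pow, hd, hs, Units.val_one, norm_one, one_mul, PNat.one_coe,
    pow_one]
  change (X.region.tip : ℝ) = (Y.region.tip : ℝ)
  rw [ht]

/-- The pull-back arrow `(b, 1, 1) : B₀ → A₀` is an isometry. [cite: MochizukiFrdII2008, Ex 3.3 (iii) p.29] -/
theorem isIsometry_liftFst : PreFrobenioid.IsIsometry C0.toElem (QuotientLift.liftFst π Q.obj fD) :=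
  isIsometry_of_one_one _ rfl rfl (QuotientLift.liftRegion_spec π Q.obj fD).2.1

/-- The lift `B → A` is an isometry of `C`, i.e. an arrow of `A`. [cite: MochizukiFrdII2008, Ex 3.3 (iii) p.29] -/
theorem isIsometry_liftMor :
    PreFrobenioid.IsIsometry (C.toElem π) (QuotientLift.liftMor π Q.obj fD) :=
  (PreFrobenioid.isIsometry_fiberProduct_iff _).2 (isIsometry_liftFst π Q fD)

/-- The object `B` of `A`. [cite: MochizukiFrdII2008, Prop 3.5 (i) p.34] -/
abbrev liftObjA : ArchFrd.A π := ⟨QuotientLift.liftObj π Q.obj fD⟩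

/-- **The pull-back morphism `B → A` OF `A` lifting `B_D → A_D`.** [cite: MochizukiFrdII2008, Prop 3.5 (i) p.34] -/
def liftMorA : liftObjA π Q fD ⟶ Q := ⟨QuotientLift.liftMor π Q.obj fD, isIsometry_liftMor π Q fD⟩

/-- The underlying arrow of `liftMorA`. [cite: MochizukiFrdII2008, Prop 3.5 (i) p.34] -/
@[simp] theorem liftMorA_hom : (liftMorA π Q fD).hom = QuotientLift.liftMor π Q.obj fD := rfl

/-- `liftMorA` is a pull-back morphism of `A` (the `C`-universal arrow into `B` of an `A`-test datum is
an isometry by sharpness). [cite: MochizukiFrdII2008, Prop 3.5 (i) p.34] -/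
theorem isPullbackMorphism_liftMorA :
    PreFrobenioid.IsPullbackMorphism (ArchFrd.A.toElem π) (liftMorA π Q fD) := by
  intro X
  have hC := QuotientLift.isPullbackMorphism_liftMor π Q.obj fD X.obj
  constructor
  · intro γ₁ γ₂ h
    apply WideSubcategory.hom_ext _
    apply hC.1
    have h1 := congrArg (fun p : PreFrobenioid.PullbackHomData (ArchFrd.A.toElem π) (liftMorA π Q fD) X =>
      p.1.1.hom) h
    have h2 := congrArg (fun p : PreFrobenioid.PullbackHomData (ArchFrd.A.toElem π) (liftMorA π Q fD) X =>
      p.1.2) h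
    exact Subtype.ext (Prod.ext h1 h2)
  · rintro ⟨⟨ψ, δ⟩, hψδ⟩
    obtain ⟨γ, hγ⟩ := hC.2 ⟨(ψ.hom, δ), hψδ⟩
    have h1 : γ ≫ QuotientLift.liftMor π Q.obj fD = ψ.hom :=
      congrArg (fun p : PreFrobenioid.PullbackHomData (C.toElem π) _ X.obj => p.1.1) hγ
    have h2 : PreFrobenioid.Base (C.toElem π) γ = δ :=
      congrArg (fun p : PreFrobenioid.PullbackHomData (C.toElem π) _ X.obj => p.1.2) hγ
    have hγi : PreFrobenioid.IsIsometry (C.toElem π) γ :=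
      (C.isIsometry_of_fac π γ _ (h1 ▸ ψ.property)).1
    refine ⟨⟨γ, hγi⟩, Subtype.ext (Prod.ext (WideSubcategory.hom_ext _ h1) h2)⟩

/-- The twist `(σ, 1, 1)` of `B₀` is an isometry. [cite: MochizukiFrdII2008, Ex 3.3 (iii) p.29] -/
theorem isIsometry_twistEnd (σ : π.obj BD ⟶ π.obj BD)
    (hσ : σ ≫ QuotientLift.liftBase π Q.obj fD = QuotientLift.liftBase π Q.obj fD) :
    PreFrobenioid.IsIsometry C0.toElem (QuotientLift.twistEnd π Q.obj fD σ hσ) :=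
  isIsometry_of_one_one _ rfl rfl rfl

/-- **The lifted automorphism `((π g, 1, 1), g)` of `B` in `A`.** [cite: MochizukiFrdII2008, Prop 3.5 (i) p.34] -/
def liftAutA (g : Aut BD) (hg : g.hom ≫ fD = fD) : liftObjA π Q fD ≅ liftObjA π Q fD :=
  CategoryTheory.isoMk (QuotientLift.liftAut π Q.obj fD g hg)
    ((PreFrobenioid.isIsometry_fiberProduct_iff _).2
      (isIsometry_twistEnd π Q fD (π.map g.hom) (QuotientLift.map_comp_liftBase π Q.obj fD g hg)))
    ((PreFrobenioid.isIsometry_fiberProduct_iff _).2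
      (isIsometry_twistEnd π Q fD (π.map g.hom) (QuotientLift.map_comp_liftBase π Q.obj fD g hg)))

/-- **The group homomorphism `G_D → Aut_A(B)`.** [cite: MochizukiFrdII2008, Prop 3.5 (i) p.34] -/
def liftAutHomA (hGD : ∀ g ∈ GD, g.hom ≫ fD = fD) : GD →* Aut (liftObjA π Q fD) where
  toFun g := liftAutA π Q fD g (hGD g g.2)
  map_one' := by
    apply Iso.ext
    apply WideSubcategory.hom_ext _
    exact CFP.hom_ext (C0.hom_ext (π.map_id BD) rfl rfl) rfl
  map_mul' g h := by
    apply Iso.ext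
    apply WideSubcategory.hom_ext _
    refine CFP.hom_ext (C0.hom_ext (π.map_comp _ _) rfl ?_) rfl
    change (1 : ℂˣ) = (π.map (h : Aut BD).hom).act 1 * 1 ^ ((1 : ℕ+) : ℕ)
    rw [map_one, one_pow, mul_one]

/-- `G_D → Aut_A(B)` recovers `g` on the `D`-component. [cite: MochizukiFrdII2008, Prop 3.5 (i) p.34] -/
theorem liftAutHomA_apply_snd (hGD : ∀ g ∈ GD, g.hom ≫ fD = fD) (g : GD) :
    (liftAutHomA π Q fD GD hGD g).hom.hom.snd = (g : Aut BD).hom := rfl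

/-- `G_D → Aut_A(B)` is injective. [cite: MochizukiFrdII2008, Prop 3.5 (i) p.34] -/
theorem liftAutHomA_injective (hGD : ∀ g ∈ GD, g.hom ≫ fD = fD) :
    Function.Injective (liftAutHomA π Q fD GD hGD) := by
  intro g h hgh
  apply Subtype.ext
  apply Iso.ext
  exact congrArg (fun k : Aut (liftObjA π Q fD) => k.hom.hom.snd) hgh

/-! ### Categorical quotient and mono-minimality inside `A` -/

variable {GD}

/-- `B → A` is a categorical quotient of `B` by the lifted group IN `A` (the `C`-descended arrow of an
`A`-arrow is an isometry by sharpness). [cite: MochizukiFrdII2008, Prop 3.5 (i) p.34] -/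
theorem isCategoricalQuotient_liftMorA (hq : IsCategoricalQuotient GD fD) (hsat : GaloisSaturated π fD GD) :
    IsCategoricalQuotient (liftAutHomA π Q fD GD hq.1).range (liftMorA π Q fD) := by
  have hC := QuotientLift.isCategoricalQuotient_liftMor π Q.obj fD hq hsat
  refine ⟨?_, ?_⟩
  · rintro γ ⟨g, rfl⟩
    apply WideSubcategory.hom_ext _
    exact QuotientLift.liftAut_hom_comp_liftMor π Q.obj fD (g : Aut BD) (hq.1 g g.2)
  intro X ψ hψ
  have hψC : ∀ γ ∈ (QuotientLift.liftAutHom π Q.obj fD GD hq.1).range,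
      γ.hom ≫ ψ.hom = ψ.hom := by
    rintro γ ⟨g, rfl⟩
    exact congrArg InducedWideCategory.Hom.hom (hψ (liftAutHomA π Q fD GD hq.1 g) ⟨g, rfl⟩)
  obtain ⟨ψ', hψ', hu⟩ := hC.2 ψ.hom hψC
  have hiso : PreFrobenioid.IsIsometry (C.toElem π) ψ' :=
    (C.isIsometry_of_fac π _ ψ' (hψ' ▸ ψ.property)).2
  exact ⟨⟨ψ', hiso⟩, WideSubcategory.hom_ext _ hψ',
    fun y hy => WideSubcategory.hom_ext _ (hu y.hom (congrArg InducedWideCategory.Hom.hom hy))⟩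

/-- **`B → A` is a MONO-MINIMAL categorical quotient of `B` by the lifted group IN `A`.**
[cite: MochizukiFrdII2008, Prop 3.5 (i) p.34] -/
theorem isMonoMinimalQuotient_liftMorA (hq : IsMonoMinimalQuotient GD fD)
    (hsat : GaloisSaturated π fD GD) :
    IsMonoMinimalQuotient (liftAutHomA π Q fD GD hq.1.1).range (liftMorA π Q fD) := by
  refine ⟨isCategoricalQuotient_liftMorA π Q fD hq.1 hsat, ?_⟩
  intro A' ζ φ' hfac hmono hgrp
  obtain ⟨Γ', e', he'⟩ := hgrp
  haveI := hmono
  have hfacC : ζ.hom ≫ φ'.hom = QuotientLift.liftMor π Q.obj fD :=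
    congrArg InducedWideCategory.Hom.hom hfac
  -- `ζ_D` is a monomorphism of `D` (test arrows of the argument are isometries)
  have hmonoD : Mono ζ.hom.snd :=
    QuotientLift.mono_snd_of_mono π Q.obj fD ζ.hom φ'.hom hfacC (by
      intro T t₁ t₂ h₁ h₂ h
      have ht : (⟨t₁, h₁⟩ : (⟨T⟩ : ArchFrd.A π) ⟶ liftObjA π Q fD) ≫ ζ =
          (⟨t₂, h₂⟩ : (⟨T⟩ : ArchFrd.A π) ⟶ liftObjA π Q fD) ≫ ζ :=
        WideSubcategory.hom_ext _ h
      exact congrArg InducedWideCategory.Hom.hom ((cancel_mono ζ).1 ht))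
  haveI := hmonoD
  -- the compatible group of automorphisms of `B′_D`
  let eΓ := MonoidHom.ofInjective (liftAutHomA_injective π Q fD GD hq.1.1)
  let ρ : GD →* Aut A'.obj.snd :=
    ((CFP.proj₂ (PreFrobenioid.baseFunctor C0.toElem) π).mapAut A'.obj).comp
      (((wideSubcategoryInclusion _).mapAut A').comp
        (Γ'.subtype.comp (e'.toMonoidHom.comp eΓ.toMonoidHom)))
  have hρ : ∀ g : GD, (g : Aut BD).hom ≫ ζ.hom.snd = ζ.hom.snd ≫ (ρ g).hom := fun g =>
    congrArg (fun k => CFP.Hom.snd (InducedWideCategory.Hom.hom k)) (he' (eΓ g))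
  have hρinj : Function.Injective ρ := by
    rw [injective_iff_map_eq_one]
    intro g hg1
    have h := hρ g
    rw [hg1] at h
    change (g : Aut BD).hom ≫ ζ.hom.snd = ζ.hom.snd ≫ 𝟙 _ at h
    rw [Category.comp_id] at h
    have h' : (g : Aut BD).hom = 𝟙 BD :=
      (cancel_mono ζ.hom.snd).1 (h.trans (Category.id_comp _).symm)
    apply Subtype.ext
    apply Iso.ext
    exact h'
  have hisoD : IsIso ζ.hom.snd :=
    hq.2 ζ.hom.snd φ'.hom.snd (congrArg CFP.Hom.snd hfacC) hmonoD
      ⟨ρ.range, MonoidHom.ofInjective hρinj, fun g => hρ g⟩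
  haveI := hisoD
  -- the `C₀`-component is a base-isomorphism AND a pull-back morphism, hence an isomorphism
  have hbi : PreFrobenioid.IsBaseIso C0.toElem ζ.hom.fst :=
    PreFrobenioid.isBaseIso_fst_of_isIso_snd ζ.hom
  obtain ⟨hdζ, hdφ⟩ := QuotientLift.degFr_fst_eq_one_of_fac π Q.obj fD ζ.hom φ'.hom hfacC
  have hrel := QuotientLift.scalar_rel_of_fac π Q.obj fD ζ.hom φ'.hom hfacC
  have hbase := QuotientLift.base_rel_of_fac π Q.obj fD ζ.hom φ'.hom hfacC
  have hfull : C0.scalar ζ.hom.fst • (QuotientLift.liftC0 π Q.obj fD).region.carrier =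
      C0.pullRegion A'.obj.fst (C0.Base ζ.hom.fst) := by
    have hmζ := ζ.hom.fst.mapsTo
    change C0.scalar ζ.hom.fst • (QuotientLift.liftC0 π Q.obj fD).region.carrier ^
      (C0.degFr ζ.hom.fst : ℕ) ⊆ C0.pullRegion A'.obj.fst (C0.Base ζ.hom.fst) at hmζ
    rw [hdζ, PNat.one_coe, pow_one] at hmζ
    refine Set.Subset.antisymm hmζ ?_
    have hmφ := φ'.hom.fst.mapsTo
    change C0.scalar φ'.hom.fst • A'.obj.fst.region.carrier ^ (C0.degFr φ'.hom.fst : ℕ) ⊆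
      C0.pullRegion Q.obj.fst (C0.Base φ'.hom.fst) at hmφ
    rw [hdφ, PNat.one_coe, pow_one] at hmφ
    have h1 := Set.image_mono (f := (C0.Base ζ.hom.fst).act) hmφ
    rw [Set.image_smul_distrib] at h1
    change _ ⊆ (C0.Base ζ.hom.fst).act '' C0.pullRegion Q.obj.fst (C0.Base φ'.hom.fst) at h1
    rw [← C0.pullRegion_comp, hbase, ← QuotientLift.liftRegion_carrier] at h1
    have h2 := Set.smul_set_mono (a := C0.scalar ζ.hom.fst) h1
    rw [smul_smul, mul_comm, hrel, one_smul] at h2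
    exact h2
  have hpb : PreFrobenioid.IsPullbackMorphism C0.toElem ζ.hom.fst :=
    (C0.isPullbackMorphism_iff ζ.hom.fst).2 ⟨hdζ, hfull⟩
  haveI : IsIso ζ.hom.fst :=
    (PreFrobenioid.isPullbackMorphism_and_isBaseIso_iff_isIso C0.toElem ζ.hom.fst).mp ⟨hpb, hbi⟩
  haveI : IsIso ζ.hom := CFP.isIso_of_isIso_fst_snd ζ.hom
  exact A.isIso_of_isIso_hom ζ

/-- **Proposition 3.5 (i) for `H = A`, REPAIRED (Galois saturation) — PROVED** over any functor
`π : D → D₀`. [cite: MochizukiFrdII2008, Prop 3.5 (i) p.34] -/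
theorem prop35iR_A_holds : Literature.AlgebraicGeometry.Frobenioids.ArchFrd.Prop35iR_A π := by
  intro _ Q BD fD GD hq hsat
  change BD ⟶ Q.obj.snd at fD
  refine ⟨liftObjA π Q fD, liftMorA π Q fD, Iso.refl _, (liftAutHomA π Q fD GD hq.1.1).range,
    (MonoidHom.ofInjective (liftAutHomA_injective π Q fD GD hq.1.1)).symm,
    isPullbackMorphism_liftMorA π Q fD, (Category.id_comp _).symm, fun γ => ?_,
    isMonoMinimalQuotient_liftMorA π Q fD hq hsat⟩
  have h1 := MonoidHom.apply_ofInjective_symm (liftAutHomA_injective π Q fD GD hq.1.1) γ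
  have h2 : (((MonoidHom.ofInjective (liftAutHomA_injective π Q fD GD hq.1.1)).symm γ : GD) :
      Aut BD).hom = (γ : Aut (liftObjA π Q fD)).hom.hom.snd :=
    congrArg (fun k : Aut (liftObjA π Q fD) => k.hom.hom.snd) h1
  exact (Category.comp_id _).trans (h2.symm.trans (Category.id_comp _).symm)

end QuotientLiftA

/-- **[FrdII] Prop. 3.5 (i) REPAIRED for `H = C` — discharge of the named statement `Prop35iR_C`**
(alias of `QuotientLift.prop35iR_C_holds`). [cite: MochizukiFrdII2008, Prop 3.5 (i) p.34] -/
theorem Prop35iR_C_holds : Prop35iR_C π := QuotientLift.prop35iR_C_holds π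

/-- **[FrdII] Prop. 3.5 (i) REPAIRED for `H = A` — discharge of the named statement `Prop35iR_A`**
(alias of `QuotientLiftA.prop35iR_A_holds`). [cite: MochizukiFrdII2008, Prop 3.5 (i) p.34] -/
theorem Prop35iR_A_holds : Prop35iR_A π := QuotientLiftA.prop35iR_A_holds π

end ArchFrd

end

end Literature.AlgebraicGeometry.Frobenioids
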